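import Mathlib
import Literature.RingTheory.Depth.TypeReduction
import Literature.AlgebraicGeometry.Resolution.RegularLocalRingsProofs
import HarnessLib

/-!
# The closed fibre of a regular local ring, free and finite over a regular local subring, has
# one-dimensional socle («type 1», Gorenstein fibre) — input of Király–Lütkebohmert's Conjecture 9
# for `p = 3` (memo `KL-CONJ9-STATUS.md`, item 1)

Route `ResolutionOfSingularities/WildQuotients`; helper toward the depth-0 / kill-criterion dictionary
of the crux `CyclicQuotientFourfolds` (stmt-ResolutionOfSingularities-17941, research stub
`stub_reachLowerInFX`). Setting of F. Király, W. Lütkebohmert, *Group actions of prime order on local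
normal rings*, ANT 7 (2013), §3 (∗): `A ⊆ B` regular local rings with `B` a free module-finite
`A`-module. INSTEAD of the printed length count (`ℓ(B/𝔪_B⁴) = 10 ≠ 9`, p. 71, with an induction on
`dim A`) we record the induction-free invariant: the fibre `B̄ = B/𝔪_A B` is a zero-dimensional
Gorenstein ring, i.e. its socle `(0 : 𝔪_B)_{B̄}` is a ONE-dimensional `k_B`-vector space. Proof
(Bruns–Herzog 1.2.19, tree `Literature.RingTheory.Depth.finrank_torsionBySet_quotient_eq_of_maximal`:
the type `dim_k Soc(B/xB)` does not depend on the maximal `B`-sequence `x`): the image of a regular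
system of parameters of `A` is a MAXIMAL `B`-sequence (flat base change of an `A`-sequence; maximal
because `√(𝔪_A B) = 𝔪_B`, `B` being integral over `A`), and so is a regular system of parameters of
`B`, whose quotient is the residue field (socle of dimension `1`).

* `kl_not_isSMulRegular_quotient_of_pow_mem` — no element a power of which lies in a proper ideal
  `J` is regular on `B/J`.
* `kl_radical_map_maximalIdeal_eq` — `√(𝔪_A B) = 𝔪_B` for `B` local, module-finite and faithfully
  flat over the local subring `A`.
* `kl_finrank_socle_fiber_eq_one` — **the type-1 fibre theorem** above (σ-free; `A` any subring
  of `B` that is a regular local ring with `B` free and module-finite over it, `as` any weak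
  `A`-sequence generating `𝔪_A`).

Use (memo item 1, case `k_A = k_B`, `p = 3`): `dim_k B̄ = 3` and `𝔪̄² = 0` would give a socle of
dimension `2`; hence `𝔪̄` is principal, `σ` is a pseudoreflection and Conjecture 9 follows from
`kl_augIdeal_eq_span_singleton_of_pseudoreflection`.

[OURS · crux stmt-ResolutionOfSingularities-17941 · helper (def-free); setting of KiralyLutkebohmert2013
§3, tool of BrunsHerzog1998 1.2.19 / 3.2.10; counted 0; AI-level work, weaker than expert review.]
-/

-- single-problem summit: the doubled namespace component `ResolutionOfSingularities` is forced
set_option linter.dupNamespace false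

open IsLocalRing RingTheory.Sequence Submodule

namespace Summit.ResolutionOfSingularities.ResolutionOfSingularities.Theorems

universe u

variable {B : Type u} [CommRing B]

/-- If some power of `b` lies in the proper ideal `J`, then `b` is not a non-zero-divisor on `B/J`
(typed on the module quotient `B ⧸ J • ⊤` of the regular-sequence API). [folklore] -/
theorem kl_not_isSMulRegular_quotient_of_pow_mem (J : Ideal B) (hJ : J ≠ ⊤) (b : B) (n : ℕ)
    (hb : b ^ n ∈ J) : ¬ IsSMulRegular (B ⧸ (J • ⊤ : Submodule B B)) b := by
  intro h
  have hJ' : (J • ⊤ : Submodule B B) = J := by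
    rw [smul_eq_mul, Ideal.mul_top]
  have h1 : (Submodule.Quotient.mk (p := (J • ⊤ : Submodule B B)) (1 : B)) ≠ 0 := by
    intro h0
    rw [Submodule.Quotient.mk_eq_zero, hJ'] at h0
    exact hJ ((Ideal.eq_top_iff_one J).mpr h0)
  have h2 : b ^ n • (Submodule.Quotient.mk (p := (J • ⊤ : Submodule B B)) (1 : B)) = 0 := by
    rw [← Submodule.Quotient.mk_smul, Submodule.Quotient.mk_eq_zero]
    simp only [smul_eq_mul, mul_one, Ideal.mul_top]
    exact hb
  have h3 := IsSMulRegular.pow n h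
  exact h1 (h3 (h2.trans (smul_zero _).symm))

/-- **`√(𝔪_A B) = 𝔪_B`**: for a local ring `B`, module-finite and faithfully flat over a subring
`A` that is a local ring, the radical of the extended maximal ideal `𝔪_A B` is `𝔪_B` (every prime
of `B` above `𝔪_A` is maximal since `B` is integral over `A`; `𝔪_A B ≠ B` by faithful flatness).
[folklore; cf. KiralyLutkebohmert2013 §3 «`B` is a free `A`-module of rank `p`»] -/
theorem kl_radical_map_maximalIdeal_eq [IsLocalRing B] (A : Subring B) [IsLocalRing A]
    [Module.Finite A B] [Module.FaithfullyFlat A B] :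
    (Ideal.map (algebraMap A B) (maximalIdeal A)).radical = maximalIdeal B := by
  set J := Ideal.map (algebraMap A B) (maximalIdeal A) with hJ_def
  have hJne : J ≠ ⊤ := by
    intro htop
    apply Module.FaithfullyFlat.submodule_ne_top (M := B) (maximalIdeal.isMaximal A)
    rw [Ideal.smul_top_eq_map, ← hJ_def, htop]
    simp
  apply le_antisymm
  · exact (maximalIdeal.isMaximal B).isPrime.radical_le_iff.mpr (le_maximalIdeal hJne)
  · rw [Ideal.radical_eq_sInf]
    refine le_sInf fun P hP => ?_
    obtain ⟨hJP, hPprime⟩ := hP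
    haveI : P.IsPrime := hPprime
    have hcomap : (P.comap (algebraMap A B)) = maximalIdeal A := by
      refine (maximalIdeal.isMaximal A).eq_of_le ?_ ?_ |>.symm
      · exact Ideal.IsPrime.ne_top inferInstance
      · rw [← Ideal.map_le_iff_le_comap]
        exact hJP
    have hPmax : P.IsMaximal :=
      Ideal.isMaximal_of_isIntegral_of_isMaximal_comap P (hcomap ▸ maximalIdeal.isMaximal A)
    rw [IsLocalRing.eq_maximalIdeal hPmax]

/-- **Type-1 fibre**: let `B` be a regular local ring which is a FREE module-finite module over a
subring `A` that is itself a regular local ring, and let `as` be a weak `A`-sequence generating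
`𝔪_A` (e.g. a regular system of parameters, `exists_isRegular_ofList_eq_maximalIdeal`). Then the
socle `(0 : 𝔪_B)` of the fibre `B / 𝔪_A B = B ⧸ (as)B` is a one-dimensional vector space over
`k_B = B/𝔪_B`: the fibre is a Gorenstein Artinian local ring. [cite: BrunsHerzog1998, Lemma 1.2.19 and Thm. 3.2.10 (proof)] -/
theorem kl_finrank_socle_fiber_eq_one [IsRegularLocalRing B] (A : Subring B) [IsRegularLocalRing A]
    [Module.Finite A B] [Module.Free A B]
    (as : List A) (has : IsWeaklyRegular A as) (hasm : Ideal.ofList as = maximalIdeal A) :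
    Module.finrank (B ⧸ maximalIdeal B)
      (torsionBySet B (B ⧸ (Ideal.ofList (as.map (algebraMap A B)) • ⊤ : Submodule B B))
        (maximalIdeal B : Set B)) = 1 := by
  classical
  haveI : Nontrivial B := inferInstance
  haveI : Module.FaithfullyFlat A B := inferInstance
  set xs : List B := as.map (algebraMap A B) with hxs_def
  -- the extended maximal ideal
  have hJ : Ideal.ofList xs = Ideal.map (algebraMap A B) (maximalIdeal A) := by
    rw [hxs_def, ← Ideal.map_ofList, hasm]
  have hrad : (Ideal.ofList xs).radical = maximalIdeal B := by
    rw [hJ]; exact kl_radical_map_maximalIdeal_eq A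
  have hJne : Ideal.ofList xs ≠ ⊤ := by
    intro htop
    have : (Ideal.ofList xs).radical = ⊤ := by rw [htop, Ideal.radical_top]
    rw [hrad] at this
    exact (maximalIdeal.isMaximal B).ne_top this
  -- (1) `xs` is a weak `B`-sequence in `𝔪_B`, maximal
  have hx : IsWeaklyRegular B xs := has.of_flat
  have hxm : ∀ r ∈ xs, r ∈ maximalIdeal B := by
    intro r hr
    have : r ∈ Ideal.ofList xs := Ideal.subset_span hr
    exact le_maximalIdeal hJne this
  have hxmax : ∀ b ∈ maximalIdeal B, ¬ IsWeaklyRegular B (xs ++ [b]) := by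
    intro b hb hreg
    rw [isWeaklyRegular_append_iff, isWeaklyRegular_cons_iff] at hreg
    obtain ⟨-, hbreg, -⟩ := hreg
    have hbrad : b ∈ (Ideal.ofList xs).radical := by rw [hrad]; exact hb
    obtain ⟨n, hn⟩ := hbrad
    exact kl_not_isSMulRegular_quotient_of_pow_mem (Ideal.ofList xs) hJne b n hn hbreg
  -- (2) a regular system of parameters of `B` is a maximal `B`-sequence with quotient the residue field
  obtain ⟨ys, hyreg, hym, -⟩ :=
    Literature.AlgebraicGeometry.Resolution.exists_isRegular_ofList_eq_maximalIdeal (R := B)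
  have hy : IsWeaklyRegular B ys := hyreg.toIsWeaklyRegular
  have hym' : ∀ r ∈ ys, r ∈ maximalIdeal B := fun r hr => hym ▸ Ideal.subset_span hr
  have hymax : ∀ b ∈ maximalIdeal B, ¬ IsWeaklyRegular B (ys ++ [b]) := by
    intro b hb hreg
    rw [isWeaklyRegular_append_iff, isWeaklyRegular_cons_iff] at hreg
    obtain ⟨-, hbreg, -⟩ := hreg
    refine kl_not_isSMulRegular_quotient_of_pow_mem (Ideal.ofList ys) ?_ b 1 ?_ hbreg
    · rw [hym]; exact (maximalIdeal.isMaximal B).ne_top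
    · rw [pow_one, hym]; exact hb
  have e : (B ⧸ (Ideal.ofList ys • ⊤ : Submodule B B)) ≃ₗ[B] (B ⧸ maximalIdeal B) :=
    Submodule.quotEquivOfEq _ _ (by rw [smul_eq_mul, Ideal.mul_top, hym])
  have h1 : Module.finrank (B ⧸ maximalIdeal B)
      (torsionBySet B (B ⧸ (Ideal.ofList ys • ⊤ : Submodule B B)) (maximalIdeal B : Set B)) = 1 :=
    Literature.RingTheory.Depth.finrank_torsionBySet_eq_one_of_equiv_residue e
  rw [← h1]
  exact Literature.RingTheory.Depth.finrank_torsionBySet_quotient_eq_of_maximal B hx hxm hxmax hy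
    hym' hymax

end Summit.ResolutionOfSingularities.ResolutionOfSingularities.Theorems
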